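import Summits.NavierStokesRegularity.NavierStokesRegularity.Theses.OddMorawetz
import Literature.Analysis.FluidPDE.EulerBilinearSymbol

/-!
# Jet decay for `OddMorawetzLocal` (stmt-NavierStokesRegularity-1376), II: homogeneous symbols and the Leray symbol

Support file for the birth-skeleton stub `stub_jetDecay` of the crux `OddMorawetzLocal` (T. Tao, J. Amer. Math.
Soc. 29 (2016), §1.1: `P div(v ⊗ v) = O(|x|^{-d-1})` for Schwartz divergence-free `v` on `ℝ³`).

* **Homogeneous symbols** (`pow_mul_norm_iteratedFDeriv_le_of_homogeneous`, `symbol_estimates_of_homogeneous`): if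
  `ρ : ℝ³ → ℝ` is smooth off the origin and positively homogeneous of degree `k`, then `|ξ|ⁱ ‖Dⁱρ(ξ)‖ ≤ Cᵢ |ξ|ᵏ`
  (Euler scaling `Dⁱρ(ξ) = tᵏ Dⁱρ(ξ/t) ∘ (t⁻¹, …, t⁻¹)`, `t = |ξ|`, and `Dⁱρ` is bounded on the unit sphere); hence
  for `k ≥ 1` and `T` Schwartz, `Φ = ρ • T` satisfies `|ξ|ᵐ ‖DᵐΦ(ξ)‖ ≤ Cₘ |ξ|` on the punctured unit ball and
  `|ξ|⁴ ‖DᵐΦ(ξ)‖ ≤ C'ₘ` off it (Leibniz rule, `norm_iteratedFDeriv_smul_le_off_zero`); `homogeneous_div_normSq`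
  treats `p(ξ)/|ξ|²` for a homogeneous numerator `p`.
* **The Leray symbol on `𝓕[2(v·∇)v]`** (`fourierPowSMulRight_symbol_apply`, `integrable_pow_mul_norm_symbol`):
  with the tree's representation `P̂ ŵ = ŵ + s`, `s(ξ) = ∑ₖ (𝓕gₖ(ξ)/(4π²|ξ|²)) eₖ`, `gₖ = ∑ₘ ∂ₖ∂_{m₁}∂_{m₂} S_{k,m}`
  (`exists_leraySymbolC_fourier_repr`), the basis coefficients of `(-2πi ξ·)^{⊗n} s(ξ)` are finite sums of
  `(homogeneous symbol of degree n + 1) • (Schwartz) • eₖ`, and all moments `|ξ|ʲ ‖s(ξ)‖` are integrable.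

Everything is proved; no definitions.
-/

noncomputable section

open MeasureTheory Filter Topology Set FourierTransform Metric Complex VectorFourier
open Literature.Analysis Literature.Analysis.FluidPDE
open scoped Real RealInnerProductSpace ContDiff SchwartzMap LineDeriv

-- the problem namespace `Summit.NavierStokesRegularity.NavierStokesRegularity` repeats the summit name by design (D-0017)
set_option linter.dupNamespace false

namespace Summit.NavierStokesRegularity.NavierStokesRegularity.Theorems

namespace JetDecay

/-- Frequency / physical space `ℝ³`. -/
local notation "E3" => EuclideanSpace ℝ (Fin 3)

/-! ### The Leibniz rule off the origin -/

/-- Leibniz bound for a real multiplier times a symbol, both smooth off the origin. -/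
theorem norm_iteratedFDeriv_smul_le_off_zero {θ : E3 → ℝ} {F : E3 → ℂ}
    (hθ : ContDiffOn ℝ ∞ θ {0}ᶜ) (hF : ContDiffOn ℝ ∞ F {0}ᶜ) {ξ : E3} (hξ : ξ ≠ 0) (m : ℕ) :
    ‖iteratedFDeriv ℝ m (fun η => θ η • F η) ξ‖ ≤
      ∑ i ∈ Finset.range (m + 1), (m.choose i : ℝ) * ‖iteratedFDeriv ℝ i θ ξ‖ *
        ‖iteratedFDeriv ℝ (m - i) F ξ‖ := by
  have hs : IsOpen ({0}ᶜ : Set E3) := isOpen_compl_singleton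
  have hmem : ξ ∈ ({0}ᶜ : Set E3) := hξ
  have h := norm_iteratedFDerivWithin_smul_le (𝕜 := ℝ) (N := ∞) hθ hF hs.uniqueDiffOn hmem
    (n := m) (by exact_mod_cast le_top)
  rw [iteratedFDerivWithin_of_isOpen m hs hmem] at h
  refine h.trans (le_of_eq (Finset.sum_congr rfl fun i _ => ?_))
  rw [iteratedFDerivWithin_of_isOpen i hs hmem, iteratedFDerivWithin_of_isOpen (m - i) hs hmem]

/-! ### Homogeneous symbols -/

/-- **Euler scaling of derivatives.** If `ρ` is smooth off the origin and positively homogeneous of degree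
`k`, then `|ξ|ⁱ ‖Dⁱρ(ξ)‖ ≤ Cᵢ |ξ|ᵏ` for `ξ ≠ 0`: `Dⁱρ(ξ) = tᵏ Dⁱρ(ξ/t) ∘ (t⁻¹, …, t⁻¹)`, `t = |ξ|`, and `Dⁱρ` is
bounded on the unit sphere. -/
theorem pow_mul_norm_iteratedFDeriv_le_of_homogeneous {ρ : E3 → ℝ} {k : ℕ}
    (hρ : ContDiffOn ℝ ∞ ρ {0}ᶜ) (hhom : ∀ t : ℝ, 0 < t → ∀ ξ, ρ (t • ξ) = t ^ k * ρ ξ) (i : ℕ) :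
    ∃ C, 0 ≤ C ∧ ∀ ξ : E3, ξ ≠ 0 → ‖ξ‖ ^ i * ‖iteratedFDeriv ℝ i ρ ξ‖ ≤ C * ‖ξ‖ ^ k := by
  have hs : IsOpen ({0}ᶜ : Set E3) := isOpen_compl_singleton
  -- `Dⁱρ` is continuous off the origin, hence bounded on the unit sphere
  have hcont : ContinuousOn (iteratedFDeriv ℝ i ρ) {0}ᶜ := by
    have h := hρ.continuousOn_iteratedFDerivWithin (m := i) (by exact_mod_cast le_top)
      hs.uniqueDiffOn
    exact h.congr fun ξ hξ => (iteratedFDerivWithin_of_isOpen i hs hξ).symm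
  have hsph : sphere (0 : E3) 1 ⊆ ({0}ᶜ : Set E3) := by
    intro η hη h0
    rw [mem_sphere_zero_iff_norm] at hη
    rw [Set.mem_singleton_iff] at h0
    rw [h0, norm_zero] at hη
    exact zero_ne_one hη
  obtain ⟨M, hM⟩ := (isCompact_sphere (0 : E3) 1).exists_bound_of_continuousOn (hcont.mono hsph)
  refine ⟨max M 0, le_max_right _ _, fun ξ hξ => ?_⟩
  set t : ℝ := ‖ξ‖ with ht
  have ht0 : 0 < t := norm_pos_iff.2 hξ
  set η : E3 := t⁻¹ • ξ with hη
  have hηs : η ∈ sphere (0 : E3) 1 := by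
    rw [mem_sphere_zero_iff_norm, hη, norm_smul, norm_inv, Real.norm_of_nonneg ht0.le, ← ht,
      inv_mul_cancel₀ ht0.ne']
  have hη0 : η ≠ 0 := fun h => hsph hηs h
  -- the dilation by `t⁻¹` as a continuous linear equivalence
  set g : E3 ≃L[ℝ] E3 := ContinuousLinearEquiv.equivOfInverse (t⁻¹ • ContinuousLinearMap.id ℝ E3)
    (t • ContinuousLinearMap.id ℝ E3) (fun y => by simp [smul_smul, ht0.ne'])
    (fun y => by simp [smul_smul, ht0.ne']) with hg
  have hgapply : ∀ y, g y = t⁻¹ • y := fun y => by simp [hg]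
  have hcomp : ρ = (fun y => ρ (t • y)) ∘ g := by
    funext y
    simp only [Function.comp_apply, hgapply, smul_smul, mul_inv_cancel₀ ht0.ne', one_smul]
  have hscale : (fun y => ρ (t • y)) = t ^ k • ρ := by
    funext y
    rw [hhom t ht0 y, Pi.smul_apply, smul_eq_mul]
  have hD : iteratedFDeriv ℝ i ρ ξ = (iteratedFDeriv ℝ i (fun y => ρ (t • y)) (g ξ)).compContinuousLinearMap
      fun _ => (g : E3 →L[ℝ] E3) := by
    have h := g.iteratedFDerivWithin_comp_right (fun y => ρ (t • y)) uniqueDiffOn_univ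
      (mem_univ (g ξ)) i
    rw [preimage_univ, iteratedFDerivWithin_univ, iteratedFDerivWithin_univ, ← hcomp] at h
    exact h
  have hgξ : g ξ = η := by rw [hgapply]
  have hD2 : iteratedFDeriv ℝ i (fun y => ρ (t • y)) η = t ^ k • iteratedFDeriv ℝ i ρ η := by
    rw [hscale]
    exact iteratedFDeriv_const_smul_apply
      ((hρ.contDiffAt (hs.mem_nhds hη0)).of_le (by exact_mod_cast le_top))
  have hgnorm : ‖(g : E3 →L[ℝ] E3)‖ ≤ t⁻¹ := by
    have h1 : (g : E3 →L[ℝ] E3) = t⁻¹ • ContinuousLinearMap.id ℝ E3 := by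
      ext y
      simp [hgapply]
    rw [h1, norm_smul, norm_inv, Real.norm_of_nonneg ht0.le]
    exact mul_le_of_le_one_right (by positivity) ContinuousLinearMap.norm_id_le
  have hMη : ‖iteratedFDeriv ℝ i ρ η‖ ≤ max M 0 := (hM η hηs).trans (le_max_left _ _)
  -- assemble
  rw [hD, hgξ, hD2]
  calc t ^ i * ‖(t ^ k • iteratedFDeriv ℝ i ρ η).compContinuousLinearMap
        fun _ => (g : E3 →L[ℝ] E3)‖
      ≤ t ^ i * (‖t ^ k • iteratedFDeriv ℝ i ρ η‖ * ∏ _j : Fin i, ‖(g : E3 →L[ℝ] E3)‖) := by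
        gcongr
        exact ContinuousMultilinearMap.norm_compContinuousLinearMap_le _ _
    _ ≤ t ^ i * ((t ^ k * max M 0) * t⁻¹ ^ i) := by
        rw [Finset.prod_const, Finset.card_univ, Fintype.card_fin, norm_smul, norm_pow,
          Real.norm_of_nonneg ht0.le]
        gcongr
    _ = max M 0 * t ^ k * (t ^ i * (t ^ i)⁻¹) := by rw [inv_pow]; ring
    _ = max M 0 * t ^ k := by rw [mul_inv_cancel₀ (pow_ne_zero i ht0.ne'), mul_one]

/-- **Homogeneous symbols times Schwartz functions satisfy the hypotheses of the kernel estimate**: for `ρ`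
smooth off the origin and positively homogeneous of degree `k ≥ 1` and `T` Schwartz, `Φ = ρ • T` is smooth off
the origin with `|ξ|ᵐ ‖DᵐΦ(ξ)‖ ≤ Cₘ |ξ|` on the punctured unit ball and `|ξ|⁴ ‖DᵐΦ(ξ)‖ ≤ C'ₘ` off it (Leibniz
rule and the Schwartz seminorms of `T`). -/
theorem symbol_estimates_of_homogeneous {ρ : E3 → ℝ} {k : ℕ} (hk : 1 ≤ k)
    (hρ : ContDiffOn ℝ ∞ ρ {0}ᶜ) (hhom : ∀ t : ℝ, 0 < t → ∀ ξ, ρ (t • ξ) = t ^ k * ρ ξ)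
    (T : 𝓢(E3, ℂ)) :
    ContDiffOn ℝ ∞ (fun ξ => ρ ξ • T ξ) {0}ᶜ ∧
    (∀ m : ℕ, ∃ C, ∀ ξ : E3, ξ ≠ 0 → ‖ξ‖ ≤ 1 →
      ‖ξ‖ ^ m * ‖iteratedFDeriv ℝ m (fun ξ => ρ ξ • T ξ) ξ‖ ≤ C * ‖ξ‖) ∧
    (∀ m : ℕ, ∃ C, ∀ ξ : E3, 1 ≤ ‖ξ‖ →
      ‖ξ‖ ^ 4 * ‖iteratedFDeriv ℝ m (fun ξ => ρ ξ • T ξ) ξ‖ ≤ C) := by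
  have hT : ContDiff ℝ ∞ (⇑T) := T.smooth _
  have hΦ : ContDiffOn ℝ ∞ (fun ξ => ρ ξ • T ξ) {0}ᶜ := hρ.smul hT.contDiffOn
  choose Cρ hCρ0 hCρ using fun i => pow_mul_norm_iteratedFDeriv_le_of_homogeneous hρ hhom i
  refine ⟨hΦ, fun m => ?_, fun m => ?_⟩
  · -- on the punctured unit ball
    refine ⟨∑ i ∈ Finset.range (m + 1), (m.choose i : ℝ) * Cρ i * SchwartzMap.seminorm ℝ 0 (m - i) T,
      fun ξ hξ h1 => ?_⟩
    have ht0 : 0 < ‖ξ‖ := norm_pos_iff.2 hξ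
    have hL := norm_iteratedFDeriv_smul_le_off_zero hρ hT.contDiffOn hξ m
    refine (mul_le_mul_of_nonneg_left hL (by positivity)).trans ?_
    rw [Finset.mul_sum, Finset.sum_mul]
    refine Finset.sum_le_sum fun i hi => ?_
    have hi' : i ≤ m := Nat.lt_succ_iff.1 (Finset.mem_range.1 hi)
    have := hCρ0 i
    have h1' : ‖ξ‖ ^ m * ‖iteratedFDeriv ℝ i ρ ξ‖ ≤ Cρ i * ‖ξ‖ := by
      calc ‖ξ‖ ^ m * ‖iteratedFDeriv ℝ i ρ ξ‖
          = ‖ξ‖ ^ (m - i) * (‖ξ‖ ^ i * ‖iteratedFDeriv ℝ i ρ ξ‖) := by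
            rw [← mul_assoc, ← pow_add, Nat.sub_add_cancel hi']
        _ ≤ 1 * (Cρ i * ‖ξ‖ ^ k) :=
            mul_le_mul (pow_le_one₀ (norm_nonneg _) h1) (hCρ i ξ hξ) (by positivity) zero_le_one
        _ ≤ Cρ i * ‖ξ‖ := by
            rw [one_mul]
            refine mul_le_mul_of_nonneg_left ?_ (hCρ0 i)
            calc ‖ξ‖ ^ k ≤ ‖ξ‖ ^ 1 := pow_le_pow_of_le_one ht0.le h1 hk
              _ = ‖ξ‖ := pow_one _
    have h2' : ‖iteratedFDeriv ℝ (m - i) (⇑T) ξ‖ ≤ SchwartzMap.seminorm ℝ 0 (m - i) T :=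
      SchwartzMap.norm_iteratedFDeriv_le_seminorm ℝ T (m - i) ξ
    calc ‖ξ‖ ^ m * ((m.choose i : ℝ) * ‖iteratedFDeriv ℝ i ρ ξ‖ * ‖iteratedFDeriv ℝ (m - i) (⇑T) ξ‖)
        = (m.choose i : ℝ) * (‖ξ‖ ^ m * ‖iteratedFDeriv ℝ i ρ ξ‖) *
            ‖iteratedFDeriv ℝ (m - i) (⇑T) ξ‖ := by ring
      _ ≤ (m.choose i : ℝ) * (Cρ i * ‖ξ‖) * SchwartzMap.seminorm ℝ 0 (m - i) T := by gcongr
      _ = (m.choose i : ℝ) * Cρ i * SchwartzMap.seminorm ℝ 0 (m - i) T * ‖ξ‖ := by ring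
  · -- off the unit ball
    refine ⟨∑ i ∈ Finset.range (m + 1),
      (m.choose i : ℝ) * Cρ i * SchwartzMap.seminorm ℝ (k + 4) (m - i) T, fun ξ h1 => ?_⟩
    have ht0 : 0 < ‖ξ‖ := by linarith
    have hξ : ξ ≠ 0 := norm_pos_iff.1 ht0
    have hL := norm_iteratedFDeriv_smul_le_off_zero hρ hT.contDiffOn hξ m
    refine (mul_le_mul_of_nonneg_left hL (by positivity)).trans ?_
    rw [Finset.mul_sum]
    refine Finset.sum_le_sum fun i hi => ?_
    have := hCρ0 i
    have h1' : ‖iteratedFDeriv ℝ i ρ ξ‖ ≤ Cρ i * ‖ξ‖ ^ k := by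
      calc ‖iteratedFDeriv ℝ i ρ ξ‖ = 1 * ‖iteratedFDeriv ℝ i ρ ξ‖ := (one_mul _).symm
        _ ≤ ‖ξ‖ ^ i * ‖iteratedFDeriv ℝ i ρ ξ‖ :=
            mul_le_mul_of_nonneg_right (one_le_pow₀ h1) (norm_nonneg _)
        _ ≤ Cρ i * ‖ξ‖ ^ k := hCρ i ξ hξ
    have h2' : ‖ξ‖ ^ (k + 4) * ‖iteratedFDeriv ℝ (m - i) (⇑T) ξ‖ ≤
        SchwartzMap.seminorm ℝ (k + 4) (m - i) T :=
      SchwartzMap.le_seminorm ℝ (k + 4) (m - i) T ξ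
    calc ‖ξ‖ ^ 4 * ((m.choose i : ℝ) * ‖iteratedFDeriv ℝ i ρ ξ‖ * ‖iteratedFDeriv ℝ (m - i) (⇑T) ξ‖)
        ≤ ‖ξ‖ ^ 4 * ((m.choose i : ℝ) * (Cρ i * ‖ξ‖ ^ k) * ‖iteratedFDeriv ℝ (m - i) (⇑T) ξ‖) := by
          gcongr
      _ = (m.choose i : ℝ) * Cρ i * (‖ξ‖ ^ (k + 4) * ‖iteratedFDeriv ℝ (m - i) (⇑T) ξ‖) := by ring
      _ ≤ (m.choose i : ℝ) * Cρ i * SchwartzMap.seminorm ℝ (k + 4) (m - i) T := by gcongr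

/-- The symbol `p(ξ)/|ξ|²` of a smooth positively homogeneous numerator `p` of degree `r ≥ 2` is smooth off the
origin and positively homogeneous of degree `r - 2`. -/
theorem homogeneous_div_normSq {p : E3 → ℝ} (hp : ContDiff ℝ ∞ p) {r : ℕ} (hr : 2 ≤ r)
    (hhom : ∀ t : ℝ, 0 < t → ∀ ξ, p (t • ξ) = t ^ r * p ξ) :
    ContDiffOn ℝ ∞ (fun ξ => p ξ / ‖ξ‖ ^ 2) {0}ᶜ ∧
      ∀ t : ℝ, 0 < t → ∀ ξ : E3, p (t • ξ) / ‖t • ξ‖ ^ 2 = t ^ (r - 2) * (p ξ / ‖ξ‖ ^ 2) := by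
  refine ⟨?_, fun t ht ξ => ?_⟩
  · refine hp.contDiffOn.div (contDiff_norm_sq ℝ).contDiffOn fun ξ hξ => ?_
    have hξ' : ξ ≠ 0 := hξ
    have : 0 < ‖ξ‖ := norm_pos_iff.2 hξ'
    positivity
  · rw [hhom t ht ξ, norm_smul, Real.norm_of_nonneg ht.le]
    rcases eq_or_ne ξ 0 with rfl | hξ
    · simp
    · have hn : ‖ξ‖ ≠ 0 := norm_ne_zero_iff.2 hξ
      have hsplit : t ^ r = t ^ (r - 2) * t ^ 2 := by rw [← pow_add, Nat.sub_add_cancel hr]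
      rw [hsplit]
      field_simp

/-! ### Fourier-side bookkeeping -/

/-- `𝓕 (Φ • e) = (𝓕 Φ) • e` for a scalar function `Φ` and a constant vector `e`. -/
theorem fourier_smul_const (Φ : E3 → ℂ) (e : EuclideanSpace ℂ (Fin 3)) (x : E3) :
    𝓕 (fun ξ => Φ ξ • e) x = 𝓕 Φ x • e := by
  rw [Real.fourier_eq, Real.fourier_eq, ← integral_smul_const]
  refine integral_congr_ae (Eventually.of_forall fun ξ => ?_)
  dsimp only
  rw [Circle.smul_def, Circle.smul_def, smul_eq_mul, smul_smul]

/-- Linearity of `𝓕` over finite sums of integrable vector-valued functions. -/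
theorem fourier_finset_sum {α : Type*} (s : Finset α) {f : α → E3 → EuclideanSpace ℂ (Fin 3)}
    (hf : ∀ m ∈ s, Integrable (f m)) : 𝓕 (∑ m ∈ s, f m) = ∑ m ∈ s, 𝓕 (f m) := by
  classical
  have hL : Continuous fun p : E3 × E3 => innerₗ E3 p.1 p.2 := continuous_inner
  induction s using Finset.induction_on with
  | empty =>
    funext x
    simp [Real.fourier_eq]
  | insert m s hm ih =>
    rw [Finset.sum_insert hm, Finset.sum_insert hm]
    have h1 : Integrable (f m) := hf m (Finset.mem_insert_self m s)
    have h2 : Integrable (∑ k ∈ s, f k) :=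
      integrable_finsetSum' s fun k hk => hf k (Finset.mem_insert_of_mem hk)
    have hadd := VectorFourier.fourierIntegral_add Real.continuous_fourierChar hL h1 h2
    change VectorFourier.fourierIntegral 𝐞 volume (innerₗ E3) (f m + ∑ k ∈ s, f k) = _
    rw [hadd, ← ih fun k hk => hf k (Finset.mem_insert_of_mem hk)]
    rfl

/-! ### The Leray symbol on the Fourier transform of `2(v·∇)v` -/

/-- **The symbol algebra.** With `s(ξ) = ∑ₖ (𝓕gₖ(ξ)/(4π²|ξ|²)) eₖ`, `gₖ = ∑ₘ ∂ₖ∂_{m₁}∂_{m₂} S_{k,m}`, the basis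
coefficients of `(-2πi ξ·)^{⊗n} s(ξ)` are finite sums of `(homogeneous symbol of degree n+1) • (Schwartz) • eₖ`:
`𝓕(∂ₐ∂_b∂_c S) = (2πi)³ ⟪ξ,a⟫⟪ξ,b⟫⟪ξ,c⟫ 𝓕S`. -/
theorem fourierPowSMulRight_symbol_apply (g : Fin 3 → 𝓢(E3, ℂ)) (S : Fin 3 → Fin 3 × Fin 3 → 𝓢(E3, ℂ))
    (hS : ∀ k, g k = ∑ m, (∂_{EuclideanSpace.single k (1 : ℝ)} (∂_{EuclideanSpace.single m.1 (1 : ℝ)}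
      (∂_{EuclideanSpace.single m.2 (1 : ℝ)} (S k m))) : 𝓢(E3, ℂ)))
    (n : ℕ) (α : Fin n → Fin 3) (ξ : E3) :
    fourierPowSMulRight (innerSL ℝ) (fun ξ : E3 => ∑ k, (𝓕 (⇑(g k)) ξ /
      (((2 * π) ^ 2 * ‖ξ‖ ^ 2 : ℝ) : ℂ)) • EuclideanSpace.single k (1 : ℂ)) ξ n
        (fun i => EuclideanSpace.single (α i) (1 : ℝ)) =
    ∑ σ : Fin 3 × (Fin 3 × Fin 3),
      ((((∏ i, ⟪ξ, EuclideanSpace.single (α i) (1 : ℝ)⟫) *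
          (⟪ξ, EuclideanSpace.single σ.1 (1 : ℝ)⟫ * ⟪ξ, EuclideanSpace.single σ.2.1 (1 : ℝ)⟫ *
            ⟪ξ, EuclideanSpace.single σ.2.2 (1 : ℝ)⟫)) / ‖ξ‖ ^ 2) •
        (((-(2 * π * I)) ^ n * ((2 * π * I) ^ 3 / (2 * π) ^ 2)) • 𝓕 (S σ.1 σ.2)) ξ) •
          EuclideanSpace.single σ.1 (1 : ℂ) := by
  have hFg : ∀ k, 𝓕 (⇑(g k)) ξ = ∑ m : Fin 3 × Fin 3, (2 * π * I) ^ 3 *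
      ⟪ξ, EuclideanSpace.single k (1 : ℝ)⟫ * ⟪ξ, EuclideanSpace.single m.1 (1 : ℝ)⟫ *
        ⟪ξ, EuclideanSpace.single m.2 (1 : ℝ)⟫ * 𝓕 (⇑(S k m)) ξ := by
    intro k
    rw [← SchwartzMap.fourier_coe, hS k, fourier_sum, sum_apply]
    refine Finset.sum_congr rfl fun m _ => ?_
    rw [SchwartzMap.fourier_coe, fourier_lineDeriv₃_apply]
  rw [fourierPowSMulRight_apply]
  simp only [innerSL_apply_apply ℝ, hFg, smul_apply, smul_eq_mul, SchwartzMap.fourier_coe]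
  conv_rhs => rw [Fintype.sum_prod_type]
  rw [Finset.smul_sum, Finset.smul_sum]
  refine Finset.sum_congr rfl fun k _ => ?_
  rw [Finset.sum_div, Finset.sum_smul, Finset.smul_sum, Finset.smul_sum]
  refine Finset.sum_congr rfl fun m _ => ?_
  simp only [← Complex.coe_smul, smul_smul, smul_eq_mul]
  congr 1
  push_cast
  ring

/-- **Moments of the symbol.** `|ξ|ʲ ‖s(ξ)‖ ∈ L¹` for every `j` (`|𝓕gₖ(ξ)| ≤ ∑ₘ (2π)³|ξ|³ |𝓕S_{k,m}(ξ)|`, so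
`‖s(ξ)‖ ≤ 2π|ξ| ∑ |𝓕S_{k,m}(ξ)|` with `𝓕S_{k,m}` Schwartz). -/
theorem integrable_pow_mul_norm_symbol (g : Fin 3 → 𝓢(E3, ℂ)) (S : Fin 3 → Fin 3 × Fin 3 → 𝓢(E3, ℂ))
    (hS : ∀ k, g k = ∑ m, (∂_{EuclideanSpace.single k (1 : ℝ)} (∂_{EuclideanSpace.single m.1 (1 : ℝ)}
      (∂_{EuclideanSpace.single m.2 (1 : ℝ)} (S k m))) : 𝓢(E3, ℂ))) (j : ℕ) :
    AEStronglyMeasurable (fun ξ : E3 => ∑ k, (𝓕 (⇑(g k)) ξ /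
      (((2 * π) ^ 2 * ‖ξ‖ ^ 2 : ℝ) : ℂ)) • EuclideanSpace.single k (1 : ℂ)) volume ∧
    Integrable (fun ξ : E3 => ‖ξ‖ ^ j * ‖∑ k, (𝓕 (⇑(g k)) ξ /
      (((2 * π) ^ 2 * ‖ξ‖ ^ 2 : ℝ) : ℂ)) • EuclideanSpace.single k (1 : ℂ)‖) := by
  -- measurability
  have hcont : ∀ k, Continuous (𝓕 (⇑(g k))) := fun k => by
    rw [← SchwartzMap.fourier_coe]; exact SchwartzMap.continuous _
  have hden : Continuous fun ξ : E3 => (((2 * π) ^ 2 * ‖ξ‖ ^ 2 : ℝ) : ℂ) := by fun_prop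
  have hmeas : Measurable (fun ξ : E3 => ∑ k, (𝓕 (⇑(g k)) ξ /
      (((2 * π) ^ 2 * ‖ξ‖ ^ 2 : ℝ) : ℂ)) • EuclideanSpace.single k (1 : ℂ)) :=
    Finset.measurable_sum _ fun k _ => ((hcont k).measurable.div hden.measurable).smul_const _
  refine ⟨hmeas.aestronglyMeasurable, ?_⟩
  -- the norm of `𝓕 gₖ`
  have hnormg : ∀ k ξ, ‖𝓕 (⇑(g k)) ξ‖ ≤
      ∑ m : Fin 3 × Fin 3, (2 * π) ^ 3 * ‖ξ‖ ^ 3 * ‖𝓕 (⇑(S k m)) ξ‖ := by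
    intro k ξ
    rw [← SchwartzMap.fourier_coe, hS k, fourier_sum, sum_apply]
    refine (norm_sum_le _ _).trans (Finset.sum_le_sum fun m _ => ?_)
    rw [SchwartzMap.fourier_coe]
    refine (norm_fourier_lineDeriv₃_le (S k m) _ _ _ ξ).trans (le_of_eq ?_)
    simp
  -- the majorant
  have hmaj : Integrable (fun ξ : E3 => ∑ k : Fin 3, ∑ m : Fin 3 × Fin 3,
      2 * π * (‖ξ‖ ^ (j + 1) * ‖𝓕 (⇑(S k m)) ξ‖)) := by
    refine integrable_finsetSum _ fun k _ => integrable_finsetSum _ fun m _ => ?_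
    have h := SchwartzMap.integrable_pow_mul (volume : Measure E3) (𝓕 (S k m)) (j + 1)
    rw [SchwartzMap.fourier_coe] at h
    exact h.const_mul _
  refine hmaj.mono' ((continuous_norm.pow j).measurable.mul hmeas.norm).aestronglyMeasurable
    (Eventually.of_forall fun ξ => ?_)
  rw [Real.norm_of_nonneg (by positivity)]
  calc ‖ξ‖ ^ j * ‖∑ k, (𝓕 (⇑(g k)) ξ / (((2 * π) ^ 2 * ‖ξ‖ ^ 2 : ℝ) : ℂ)) •
        EuclideanSpace.single k (1 : ℂ)‖
      ≤ ‖ξ‖ ^ j * ∑ k, ‖(𝓕 (⇑(g k)) ξ / (((2 * π) ^ 2 * ‖ξ‖ ^ 2 : ℝ) : ℂ)) •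
          EuclideanSpace.single k (1 : ℂ)‖ := by
        gcongr
        exact norm_sum_le _ _
    _ = ∑ k, ‖ξ‖ ^ j * (‖𝓕 (⇑(g k)) ξ‖ / ((2 * π) ^ 2 * ‖ξ‖ ^ 2)) := by
        rw [Finset.mul_sum]
        refine Finset.sum_congr rfl fun k _ => ?_
        rw [norm_smul, PiLp.norm_single, norm_one, mul_one, norm_div, Complex.norm_real,
          Real.norm_of_nonneg (by positivity)]
    _ ≤ ∑ k, ∑ m : Fin 3 × Fin 3, 2 * π * (‖ξ‖ ^ (j + 1) * ‖𝓕 (⇑(S k m)) ξ‖) :=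
        Finset.sum_le_sum fun k _ => by
          rcases eq_or_ne ξ 0 with rfl | hξ
          · simp
          · have hn : 0 < ‖ξ‖ := norm_pos_iff.2 hξ
            have hpos : 0 < (2 * π) ^ 2 * ‖ξ‖ ^ 2 := by positivity
            calc ‖ξ‖ ^ j * (‖𝓕 (⇑(g k)) ξ‖ / ((2 * π) ^ 2 * ‖ξ‖ ^ 2))
                ≤ ‖ξ‖ ^ j * ((∑ m : Fin 3 × Fin 3, (2 * π) ^ 3 * ‖ξ‖ ^ 3 * ‖𝓕 (⇑(S k m)) ξ‖) /
                    ((2 * π) ^ 2 * ‖ξ‖ ^ 2)) := by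
                  gcongr
                  exact hnormg k ξ
              _ = ∑ m : Fin 3 × Fin 3, 2 * π * (‖ξ‖ ^ (j + 1) * ‖𝓕 (⇑(S k m)) ξ‖) := by
                  rw [Finset.sum_div, Finset.mul_sum]
                  refine Finset.sum_congr rfl fun m _ => ?_
                  field_simp
                  ring

end JetDecay

/-- **Helper sub-goal `stub_jetDecay_symbol`** (registered on the crux item as a sub-goal of `stub_jetDecay`):
homogeneous symbols of degree `k ≥ 1`, smooth off the origin, times Schwartz functions satisfy the hypotheses of the
kernel estimate (`JetDecay.symbol_estimates_of_homogeneous`). -/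
theorem stub_jetDecay_symbol :
    ∀ (ρ : EuclideanSpace ℝ (Fin 3) → ℝ) (k : ℕ) (T : SchwartzMap (EuclideanSpace ℝ (Fin 3)) ℂ), 1 ≤ k →
      ContDiffOn ℝ (⊤ : ℕ∞) ρ {0}ᶜ → (∀ t : ℝ, 0 < t → ∀ ξ : EuclideanSpace ℝ (Fin 3), ρ (t • ξ) = t ^ k * ρ ξ)
      → ContDiffOn ℝ (⊤ : ℕ∞) (fun ξ => ρ ξ • T ξ) {0}ᶜ ∧ (∀ m : ℕ, ∃ C : ℝ, ∀ ξ : EuclideanSpace ℝ (Fin 3), ξ ≠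
      0 → ‖ξ‖ ≤ 1 → ‖ξ‖ ^ m * ‖iteratedFDeriv ℝ m (fun ξ => ρ ξ • T ξ) ξ‖ ≤ C * ‖ξ‖) ∧ (∀ m : ℕ, ∃ C : ℝ, ∀ ξ :
      EuclideanSpace ℝ (Fin 3), 1 ≤ ‖ξ‖ → ‖ξ‖ ^ 4 * ‖iteratedFDeriv ℝ m (fun ξ => ρ ξ • T ξ) ξ‖ ≤ C) :=
  fun _ _ T hk hρ hhom => JetDecay.symbol_estimates_of_homogeneous hk hρ hhom T

end Summit.NavierStokesRegularity.NavierStokesRegularity.Theorems
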